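import Summits.CriticalPhenomena.PercolationContinuityZ3.Theorems.PercNearOneGluingNoHeavyLowerTailApexForestLocal
import Mathlib.Combinatorics.SimpleGraph.Acyclic
import HarnessLib

/-!
# Kozma–Nitzan Conjecture 1 on APEX-FOREST graphs — the kernel theorem: the forest induction (semantic bridge assembled)
# (`NoHeavyLowerTail` cell, stmt-CriticalPhenomena-4575; new-inequality factory seat `prim-ineq-gen-7`, gen 4)

Support file (`--supports stmt-CriticalPhenomena-4575`); no definitions, no named facts, no sorries.  This file closes the formalisation programme
run/shared/lean/prim/prim-ineq-gen-7/LEAN-PLAN-APEXFOREST.md (paper proof PROOF-CONJ1-APEXFOREST.md): the algebraic step `ApexForestAlgebra.step` (p193880), the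
deterministic bridge `ApexForestBridge.*`, the per-edge measure identities `ApexForestMeasure.real_not_openConn_hub{,_relays,_of_side}` (M1)–(M3) and the side transfer
`ApexForest.real_local_*` are assembled by strong induction on the number of forest pairs.

SETTING (an APEX-FOREST instance): vertices `Fin n`, independent pairs with weights `w`, a hub `c`, and a finite set `D` of pairs avoiding `c` whose graph
`fromEdgeSet D` is ACYCLIC, such that every pair outside `D` not containing `c` has weight `0` — i.e. `G − c` is a forest, hub pairs `s(u,c)` arbitrary.

* `ApexForest.eventGluing_aux` — THE INDUCTION (this file): for every relay set `A ≠ ∅` and observer `o ≠ c` there is a relay `α ∈ A` with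
  `μ(o ↮ c) − μ(o ↮ A ∪ c) ≤ μ(α ↮ c) · (1 − μ(o ↮ A ∪ c))`, i.e. `μ(o ↔ A, o ↮ c) ≤ μ(α ↮ c) · μ(o ↔ A ∪ {c})`.
The packaged statements (`ApexForest.eventGluing`, KN Conjecture 1 `ApexForest.conj1`, the constant-1 event / near-one gluing) are in the sequel
`…ApexForestConjectureOne`.
[cite: KozmaNitzan2024, Conjecture 1 (p. 3, (1)); Theorem 1 / §3 (cases proved in print)] [cite: Grimmett1999, §1.3, §2.2]
-/

namespace Summit.CriticalPhenomena.PercolationContinuityZ3.Theorems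

namespace ApexForest

open MeasureTheory Set Literature.Probability.LatticeModels Literature.Probability.Percolation ApexForestBridge ApexForestWalks
open scoped Classical

variable {n : ℕ}

/-- **The forest induction.**  For an apex-forest instance (`D` acyclic avoiding `c`, weights supported on `D` and the hub pairs), every observer `o ≠ c` and
every nonempty relay set `A` admit a relay `α ∈ A` with `μ(o ↮ c) − μ(o ↮ A ∪ c) ≤ μ(α ↮ c)·(1 − μ(o ↮ A ∪ c))`.  Strong induction on `|D|`: if `o ∈ A` take
`α = o`; if `o` has no `D`-neighbour the left side vanishes; otherwise split along a `D`-pair `e = s(o,v₁)` (a bridge, by acyclicity), apply the induction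
hypothesis to the two SIDE INSTANCES (weights restricted to a side and its hub pairs, one pair fewer), transfer (`real_local_*`), and close with
`ApexForestAlgebra.step` via (M1)–(M3). [cite: KozmaNitzan2024, Conjecture 1 (p. 3, (1))] -/
theorem eventGluing_aux (k : ℕ) :
    ∀ (D : Finset (Sym2 (Fin n))) (w : Sym2 (Fin n) → unitInterval) (c o : Fin n) (A : Finset (Fin n)),
      D.card = k → (∀ p ∈ D, c ∉ p) → (SimpleGraph.fromEdgeSet (↑D : Set (Sym2 (Fin n)))).IsAcyclic →
      (∀ p : Sym2 (Fin n), p ∉ D → c ∉ p → (w p : ℝ) = 0) → o ≠ c → A.Nonempty →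
      ∃ α ∈ A, (prodBernoulli w).real (openConn o c : Set (BondConfig (Fin n)))ᶜ -
          (prodBernoulli w).real ((openConn o c : Set (BondConfig (Fin n)))ᶜ ∩
            (⋃ a ∈ A, (openConn o a : Set (BondConfig (Fin n))))ᶜ) ≤
        (prodBernoulli w).real (openConn α c : Set (BondConfig (Fin n)))ᶜ *
          (1 - (prodBernoulli w).real ((openConn o c : Set (BondConfig (Fin n)))ᶜ ∩
            (⋃ a ∈ A, (openConn o a : Set (BondConfig (Fin n))))ᶜ)) := by
  induction k using Nat.strong_induction_on with
  | _ k IH =>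
  intro D w c o A hk hDc hacyc hw hoc hA
  have hle1 : ∀ E : Set (BondConfig (Fin n)), (prodBernoulli w).real E ≤ 1 := fun E =>
    (measureReal_mono (Set.subset_univ E)).trans_eq probReal_univ
  have hY0 : 0 ≤ 1 - (prodBernoulli w).real ((openConn o c : Set (BondConfig (Fin n)))ᶜ ∩
      (⋃ a ∈ A, (openConn o a : Set (BondConfig (Fin n))))ᶜ) := sub_nonneg.2 (hle1 _)
  -- Case `o ∈ A`: the relay `o` itself certifies (`{o ↮ A} = ∅`).
  by_cases hoA : o ∈ A
  · refine ⟨o, hoA, ?_⟩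
    have h0 : (prodBernoulli w).real ((openConn o c : Set (BondConfig (Fin n)))ᶜ ∩
        (⋃ a ∈ A, (openConn o a : Set (BondConfig (Fin n))))ᶜ) = 0 := by
      have hempty : (openConn o c : Set (BondConfig (Fin n)))ᶜ ∩
          (⋃ a ∈ A, (openConn o a : Set (BondConfig (Fin n))))ᶜ = ∅ :=
        Set.subset_empty_iff.1 fun ω hω =>
          hω.2 (Set.mem_iUnion₂.2 ⟨o, hoA, (SimpleGraph.Reachable.refl o : (openGraph ω).Reachable o o)⟩)
      rw [hempty, measureReal_empty]
    rw [h0, sub_zero, sub_zero, mul_one]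
  -- Case: `o` has no `D`-neighbour — then `X = 0`.
  by_cases hnb : ∃ v₁, v₁ ≠ o ∧ s(o, v₁) ∈ D
  swap
  · obtain ⟨α, hαA⟩ := hA
    refine ⟨α, hαA, ?_⟩
    have hX : (prodBernoulli w).real (openConn o c : Set (BondConfig (Fin n)))ᶜ =
        (prodBernoulli w).real ((openConn o c : Set (BondConfig (Fin n)))ᶜ ∩
          (⋃ a ∈ A, (openConn o a : Set (BondConfig (Fin n))))ᶜ) := by
      refine ApexForestMeasure.real_eq_of_support w {p | p ∈ (↑D : Set (Sym2 (Fin n))) ∨ c ∈ p}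
        (fun p hp => ?_) (fun ω hωK => ?_)
      · simp only [Set.mem_setOf_eq, not_or, Finset.mem_coe] at hp
        exact hw p hp.1 hp.2
      · simp only [Set.mem_inter_iff, Set.mem_compl_iff, Set.mem_iUnion, not_exists]
        constructor
        · intro hnc
          refine ⟨hnc, fun a haA hoa => ?_⟩
          have h1 := (openConn_iff_openConnIn_compl_of_not_hub hnc).1 hoa
          obtain ⟨-, hR⟩ := reachable_inter_of_openConnIn_compl (D := (↑D : Set (Sym2 (Fin n)))) hωK hoc h1
          obtain ⟨p⟩ := hR
          cases p with
          | nil => exact hoA haA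
          | cons hadj _ =>
            rename_i b _
            have hb := (openGraph_adj _ o b).1 hadj
            exact hnb ⟨b, hb.2.symm, Finset.mem_coe.1 hb.1.2⟩
        · exact fun h => h.1
    rw [hX, sub_self]
    exact mul_nonneg measureReal_nonneg hY0
  -- Main case: a pair `e = s(o, v₁) ∈ D`, a bridge of the forest.
  obtain ⟨v₁, hv₁o, heD⟩ := hnb
  have hov : o ≠ v₁ := hv₁o.symm
  have heDs : s(o, v₁) ∈ (↑D : Set (Sym2 (Fin n))) := Finset.mem_coe.2 heD
  have hDc' : ∀ p ∈ (↑D : Set (Sym2 (Fin n))), c ∉ p := fun p hp => hDc p (Finset.mem_coe.1 hp)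
  have hv₁c : v₁ ≠ c := fun hvc => hDc _ heD (hvc ▸ Sym2.mem_mk_right o v₁)
  have hwD : ∀ p : Sym2 (Fin n), p ∉ (↑D : Set (Sym2 (Fin n))) → c ∉ p → (w p : ℝ) = 0 :=
    fun p hp hcp => hw p (fun hpD => hp (Finset.mem_coe.2 hpD)) hcp
  have hbridge : ¬ (SimpleGraph.fromEdgeSet ((↑D : Set (Sym2 (Fin n))) \ {s(o, v₁)})).Reachable o v₁ := by
    have hadj : (SimpleGraph.fromEdgeSet (↑D : Set (Sym2 (Fin n)))).Adj o v₁ :=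
      (SimpleGraph.fromEdgeSet_adj _).2 ⟨heDs, hov⟩
    have hb := SimpleGraph.isAcyclic_iff_forall_adj_isBridge.1 hacyc hadj
    rw [SimpleGraph.isBridge_iff, SimpleGraph.deleteEdges_fromEdgeSet] at hb
    exact hb
  -- sub-instance data common to both sides
  have hcard : (D.erase s(o, v₁)).card < k := hk ▸ Finset.card_erase_lt_of_mem heD
  have hDc₁ : ∀ p ∈ D.erase s(o, v₁), c ∉ p := fun p hp => hDc p (Finset.mem_of_mem_erase hp)
  have hacyc₁ : (SimpleGraph.fromEdgeSet (↑(D.erase s(o, v₁)) : Set (Sym2 (Fin n)))).IsAcyclic := by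
    rw [Finset.coe_erase]
    exact hacyc.anti (SimpleGraph.fromEdgeSet_mono Set.sdiff_subset)
  -- (M1), (M2), the side facts; then name the sides and the block quantities
  have hM1 := ApexForestMeasure.real_not_openConn_hub w hDc' hov heDs hbridge hwD
  have hM2 := ApexForestMeasure.real_not_openConn_hub_relays w A hDc' hov heDs hbridge hwD
  obtain ⟨hdisjS, hcSo, hcS₁, hoSo, hvS₁⟩ := ApexForestMeasure.sides_facts hDc' heDs hbridge
  set So : Set (Fin n) := {x | (SimpleGraph.fromEdgeSet ((↑D : Set (Sym2 (Fin n))) \ {s(o, v₁)})).Reachable o x} with hSo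
  set S₁ : Set (Fin n) := {x | (SimpleGraph.fromEdgeSet ((↑D : Set (Sym2 (Fin n))) \ {s(o, v₁)})).Reachable v₁ x} with hS₁
  set q : ℝ := (w s(o, v₁) : ℝ) with hq
  set a : ℝ := (prodBernoulli w).real {ω : BondConfig (Fin n) | ∀ u, ω ∈ openConnIn So o u → s(u, c) ∉ ω} with ha
  set b : ℝ := (prodBernoulli w).real {ω : BondConfig (Fin n) | ∀ u, ω ∈ openConnIn So o u → s(u, c) ∉ ω ∧ u ∉ A} with hb
  set g : ℝ := (prodBernoulli w).real {ω : BondConfig (Fin n) | ∀ u, ω ∈ openConnIn S₁ v₁ u → s(u, c) ∉ ω} with hg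
  set h : ℝ := (prodBernoulli w).real {ω : BondConfig (Fin n) | ∀ u, ω ∈ openConnIn S₁ v₁ u → s(u, c) ∉ ω ∧ u ∉ A} with hh
  have hq0 : 0 ≤ q := (w s(o, v₁)).2.1
  have hq1 : q ≤ 1 := (w s(o, v₁)).2.2
  have hb0 : 0 ≤ b := measureReal_nonneg
  have hba : b ≤ a := measureReal_mono (fun ω hω u hu => (hω u hu).1)
  have ha1 : a ≤ 1 := hle1 _
  have hh0 : 0 ≤ h := measureReal_nonneg
  have hhg : h ≤ g := measureReal_mono (fun ω hω u hu => (hω u hu).1)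
  have hg1 : g ≤ 1 := hle1 _
  ----------------------------------------------------------------
  -- CHILD BLOCK (`v₁`-side): no relay, or a certificate from the induction hypothesis
  ----------------------------------------------------------------
  have hC : g = h ∨ ∃ α₁ ∈ A, ∃ d₁ e₁ : ℝ, e₁ ≤ g - h ∧ g - h ≤ d₁ * (1 - h) ∧
      (prodBernoulli w).real (openConn α₁ c : Set (BondConfig (Fin n)))ᶜ = d₁ - q * (1 - a) * e₁ := by
    by_cases hA₁ : (A.filter fun x => x ∈ S₁).Nonempty
    · right
      -- the side instance: weights restricted to the pairs inside `S₁` and the hub pairs of `S₁`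
      set F₁ : Finset (Sym2 (Fin n)) := Finset.univ.filter fun p => p ∈ wireSet S₁ ∨ ∃ u ∈ S₁, p = s(u, c) with hF₁
      set w₁ : Sym2 (Fin n) → unitInterval := fun p => if p ∈ F₁ then w p else 0 with hw₁def
      have hon : ∀ p : Sym2 (Fin n), (p ∈ wireSet S₁ ∨ ∃ u ∈ S₁, p = s(u, c)) → w₁ p = w p := by
        intro p hp
        have hpF : p ∈ F₁ := Finset.mem_filter.2 ⟨Finset.mem_univ _, hp⟩
        simp only [hw₁def, hpF, if_true]
      have hoff : ∀ p : Sym2 (Fin n), ¬ (p ∈ wireSet S₁ ∨ ∃ u ∈ S₁, p = s(u, c)) → (w₁ p : ℝ) = 0 := by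
        intro p hp
        have hpF : p ∉ F₁ := fun h' => hp (Finset.mem_filter.1 h').2
        simp only [hw₁def, hpF, if_false]
        rfl
      have hw₁ : ∀ p : Sym2 (Fin n), p ∉ D.erase s(o, v₁) → c ∉ p → (w₁ p : ℝ) = 0 := by
        intro p hp hcp
        by_cases hpF : p ∈ wireSet S₁ ∨ ∃ u ∈ S₁, p = s(u, c)
        · rw [hon p hpF]
          rcases hpF with hW | ⟨u, _, rfl⟩
          · by_cases hpD : p ∈ D
            · exfalso
              refine hp (Finset.mem_erase.2 ⟨?_, hpD⟩)
              rintro rfl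
              exact Set.disjoint_left.1 hdisjS hoSo (mk_mem_wireSet_iff.1 hW).1
            · exact hw p hpD hcp
          · exact absurd (Sym2.mem_mk_right u c) hcp
        · exact hoff p hpF
      obtain ⟨α₁, hα₁F, hle⟩ := IH _ hcard (D.erase s(o, v₁)) w₁ c v₁ (A.filter fun x => x ∈ S₁) rfl
        hDc₁ hacyc₁ hw₁ hv₁c hA₁
      have hα₁A : α₁ ∈ A := (Finset.mem_filter.1 hα₁F).1
      have hα₁S : α₁ ∈ S₁ := (Finset.mem_filter.1 hα₁F).2
      -- transfer the three quantities of the side instance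
      have T1 : (prodBernoulli w₁).real (openConn v₁ c : Set (BondConfig (Fin n)))ᶜ = g :=
        real_local_not_openConn_hub w w₁ S₁ c v₁ hvS₁ hcS₁ hon hoff
      have T2 : (prodBernoulli w₁).real ((openConn v₁ c : Set (BondConfig (Fin n)))ᶜ ∩
          (⋃ a ∈ (A.filter fun x => x ∈ S₁), (openConn v₁ a : Set (BondConfig (Fin n))))ᶜ) = h := by
        rw [real_local_not_openConn_hub_relays w w₁ S₁ c v₁ (A.filter fun x => x ∈ S₁) hvS₁ hcS₁ hon hoff, hh]
        congr 1
        ext ω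
        simp only [Set.mem_setOf_eq, Finset.mem_filter, not_and]
        refine forall_congr' fun u => ⟨fun h1 hu => ⟨(h1 hu).1, fun huA => ?_⟩, fun h1 hu => ⟨(h1 hu).1, fun huA _ => (h1 hu).2 huA⟩⟩
        exact (h1 hu).2 huA (DCT16.pathIn_of_mem_openConnIn hu).right_mem
      have T3 : (prodBernoulli w₁).real (openConn α₁ c : Set (BondConfig (Fin n)))ᶜ =
          (prodBernoulli w).real {ω : BondConfig (Fin n) | ∀ u, ω ∈ openConnIn S₁ α₁ u → s(u, c) ∉ ω} :=
        real_local_not_openConn_hub w w₁ S₁ c α₁ hα₁S hcS₁ hon hoff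
      rw [T1, T2, T3] at hle
      -- (M3) for `α₁`
      have M3 : (prodBernoulli w).real (openConn α₁ c : Set (BondConfig (Fin n)))ᶜ =
          (prodBernoulli w).real {ω : BondConfig (Fin n) | ∀ u, ω ∈ openConnIn S₁ α₁ u → s(u, c) ∉ ω} -
            q * (prodBernoulli w).real ({ω : BondConfig (Fin n) | ∀ u, ω ∈ openConnIn S₁ α₁ u → s(u, c) ∉ ω} ∩ openConnIn S₁ α₁ v₁) *
              (1 - a) :=
        ApexForestMeasure.real_not_openConn_hub_of_side w hDc' hov heDs hbridge hα₁S hwD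
      refine ⟨α₁, hα₁A, (prodBernoulli w).real {ω : BondConfig (Fin n) | ∀ u, ω ∈ openConnIn S₁ α₁ u → s(u, c) ∉ ω},
        (prodBernoulli w).real ({ω : BondConfig (Fin n) | ∀ u, ω ∈ openConnIn S₁ α₁ u → s(u, c) ∉ ω} ∩ openConnIn S₁ α₁ v₁),
        ?_, hle, by rw [M3]; ring⟩
      -- `e₁ ≤ g − h`
      have hsub := hubClosed_conn_subset (S := S₁) (c := c) (v := v₁) hα₁A
      have hHsub : {ω : BondConfig (Fin n) | ∀ u, ω ∈ openConnIn S₁ v₁ u → s(u, c) ∉ ω ∧ u ∉ A} ⊆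
          {ω : BondConfig (Fin n) | ∀ u, ω ∈ openConnIn S₁ v₁ u → s(u, c) ∉ ω} := fun ω hω u hu => (hω u hu).1
      calc (prodBernoulli w).real ({ω : BondConfig (Fin n) | ∀ u, ω ∈ openConnIn S₁ α₁ u → s(u, c) ∉ ω} ∩ openConnIn S₁ α₁ v₁)
          ≤ (prodBernoulli w).real ({ω : BondConfig (Fin n) | ∀ u, ω ∈ openConnIn S₁ v₁ u → s(u, c) ∉ ω} \
              {ω : BondConfig (Fin n) | ∀ u, ω ∈ openConnIn S₁ v₁ u → s(u, c) ∉ ω ∧ u ∉ A}) := measureReal_mono hsub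
        _ = g - h := by rw [measureReal_sdiff hHsub MeasurableSet.of_discrete]
    · left
      have hset : {ω : BondConfig (Fin n) | ∀ u, ω ∈ openConnIn S₁ v₁ u → s(u, c) ∉ ω} =
          {ω : BondConfig (Fin n) | ∀ u, ω ∈ openConnIn S₁ v₁ u → s(u, c) ∉ ω ∧ u ∉ A} := by
        ext ω
        simp only [Set.mem_setOf_eq]
        refine forall_congr' fun u => ⟨fun h1 hu => ⟨h1 hu, fun huA => hA₁ ⟨u, ?_⟩⟩, fun h1 hu => (h1 hu).1⟩
        exact Finset.mem_filter.2 ⟨huA, (DCT16.pathIn_of_mem_openConnIn hu).right_mem⟩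
      rw [hg, hh, hset]
  ----------------------------------------------------------------
  -- ROOT BLOCK (`o`-side): the same with the roles of `o` and `v₁` exchanged
  ----------------------------------------------------------------
  have hR : a = b ∨ ∃ α' ∈ A, ∃ d' e' : ℝ, e' ≤ a - b ∧ a - b ≤ d' * (1 - b) ∧
      (prodBernoulli w).real (openConn α' c : Set (BondConfig (Fin n)))ᶜ = d' - q * (1 - g) * e' := by
    by_cases hAo : (A.filter fun x => x ∈ So).Nonempty
    · right
      set Fo : Finset (Sym2 (Fin n)) := Finset.univ.filter fun p => p ∈ wireSet So ∨ ∃ u ∈ So, p = s(u, c) with hFo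
      set wo : Sym2 (Fin n) → unitInterval := fun p => if p ∈ Fo then w p else 0 with hwodef
      have hon : ∀ p : Sym2 (Fin n), (p ∈ wireSet So ∨ ∃ u ∈ So, p = s(u, c)) → wo p = w p := by
        intro p hp
        have hpF : p ∈ Fo := Finset.mem_filter.2 ⟨Finset.mem_univ _, hp⟩
        simp only [hwodef, hpF, if_true]
      have hoff : ∀ p : Sym2 (Fin n), ¬ (p ∈ wireSet So ∨ ∃ u ∈ So, p = s(u, c)) → (wo p : ℝ) = 0 := by
        intro p hp
        have hpF : p ∉ Fo := fun h' => hp (Finset.mem_filter.1 h').2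
        simp only [hwodef, hpF, if_false]
        rfl
      have hwo : ∀ p : Sym2 (Fin n), p ∉ D.erase s(o, v₁) → c ∉ p → (wo p : ℝ) = 0 := by
        intro p hp hcp
        by_cases hpF : p ∈ wireSet So ∨ ∃ u ∈ So, p = s(u, c)
        · rw [hon p hpF]
          rcases hpF with hW | ⟨u, _, rfl⟩
          · by_cases hpD : p ∈ D
            · exfalso
              refine hp (Finset.mem_erase.2 ⟨?_, hpD⟩)
              rintro rfl
              exact Set.disjoint_left.1 hdisjS (mk_mem_wireSet_iff.1 hW).2.1 hvS₁
            · exact hw p hpD hcp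
          · exact absurd (Sym2.mem_mk_right u c) hcp
        · exact hoff p hpF
      obtain ⟨α', hα'F, hle⟩ := IH _ hcard (D.erase s(o, v₁)) wo c o (A.filter fun x => x ∈ So) rfl
        hDc₁ hacyc₁ hwo hoc hAo
      have hα'A : α' ∈ A := (Finset.mem_filter.1 hα'F).1
      have hα'S : α' ∈ So := (Finset.mem_filter.1 hα'F).2
      have T1 : (prodBernoulli wo).real (openConn o c : Set (BondConfig (Fin n)))ᶜ = a :=
        real_local_not_openConn_hub w wo So c o hoSo hcSo hon hoff
      have T2 : (prodBernoulli wo).real ((openConn o c : Set (BondConfig (Fin n)))ᶜ ∩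
          (⋃ a ∈ (A.filter fun x => x ∈ So), (openConn o a : Set (BondConfig (Fin n))))ᶜ) = b := by
        rw [real_local_not_openConn_hub_relays w wo So c o (A.filter fun x => x ∈ So) hoSo hcSo hon hoff, hb]
        congr 1
        ext ω
        simp only [Set.mem_setOf_eq, Finset.mem_filter, not_and]
        refine forall_congr' fun u => ⟨fun h1 hu => ⟨(h1 hu).1, fun huA => ?_⟩, fun h1 hu => ⟨(h1 hu).1, fun huA _ => (h1 hu).2 huA⟩⟩
        exact (h1 hu).2 huA (DCT16.pathIn_of_mem_openConnIn hu).right_mem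
      have T3 : (prodBernoulli wo).real (openConn α' c : Set (BondConfig (Fin n)))ᶜ =
          (prodBernoulli w).real {ω : BondConfig (Fin n) | ∀ u, ω ∈ openConnIn So α' u → s(u, c) ∉ ω} :=
        real_local_not_openConn_hub w wo So c α' hα'S hcSo hon hoff
      rw [T1, T2, T3] at hle
      -- (M3) for `α'`, across the bridge read from `v₁`
      have M3 : (prodBernoulli w).real (openConn α' c : Set (BondConfig (Fin n)))ᶜ =
          (prodBernoulli w).real {ω : BondConfig (Fin n) | ∀ u, ω ∈ openConnIn So α' u → s(u, c) ∉ ω} -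
            q * (prodBernoulli w).real ({ω : BondConfig (Fin n) | ∀ u, ω ∈ openConnIn So α' u → s(u, c) ∉ ω} ∩ openConnIn So α' o) *
              (1 - g) := by
        have he' : s(v₁, o) ∈ (↑D : Set (Sym2 (Fin n))) := by rw [Sym2.eq_swap]; exact heDs
        have hbridge' : ¬ (SimpleGraph.fromEdgeSet ((↑D : Set (Sym2 (Fin n))) \ {s(v₁, o)})).Reachable v₁ o := by
          rw [Sym2.eq_swap]; exact fun h' => hbridge h'.symm
        have hα' : (SimpleGraph.fromEdgeSet ((↑D : Set (Sym2 (Fin n))) \ {s(v₁, o)})).Reachable o α' := by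
          rw [Sym2.eq_swap]; exact hα'S
        have key := ApexForestMeasure.real_not_openConn_hub_of_side w hDc' hov.symm he' hbridge' hα' hwD
        rw [Sym2.eq_swap (a := v₁) (b := o)] at key
        exact key
      refine ⟨α', hα'A, (prodBernoulli w).real {ω : BondConfig (Fin n) | ∀ u, ω ∈ openConnIn So α' u → s(u, c) ∉ ω},
        (prodBernoulli w).real ({ω : BondConfig (Fin n) | ∀ u, ω ∈ openConnIn So α' u → s(u, c) ∉ ω} ∩ openConnIn So α' o),
        ?_, hle, by rw [M3]; ring⟩
      have hsub := hubClosed_conn_subset (S := So) (c := c) (v := o) hα'A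
      have hHsub : {ω : BondConfig (Fin n) | ∀ u, ω ∈ openConnIn So o u → s(u, c) ∉ ω ∧ u ∉ A} ⊆
          {ω : BondConfig (Fin n) | ∀ u, ω ∈ openConnIn So o u → s(u, c) ∉ ω} := fun ω hω u hu => (hω u hu).1
      calc (prodBernoulli w).real ({ω : BondConfig (Fin n) | ∀ u, ω ∈ openConnIn So α' u → s(u, c) ∉ ω} ∩ openConnIn So α' o)
          ≤ (prodBernoulli w).real ({ω : BondConfig (Fin n) | ∀ u, ω ∈ openConnIn So o u → s(u, c) ∉ ω} \
              {ω : BondConfig (Fin n) | ∀ u, ω ∈ openConnIn So o u → s(u, c) ∉ ω ∧ u ∉ A}) := measureReal_mono hsub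
        _ = a - b := by rw [measureReal_sdiff hHsub MeasurableSet.of_discrete]
    · left
      have hset : {ω : BondConfig (Fin n) | ∀ u, ω ∈ openConnIn So o u → s(u, c) ∉ ω} =
          {ω : BondConfig (Fin n) | ∀ u, ω ∈ openConnIn So o u → s(u, c) ∉ ω ∧ u ∉ A} := by
        ext ω
        simp only [Set.mem_setOf_eq]
        refine forall_congr' fun u => ⟨fun h1 hu => ⟨h1 hu, fun huA => hAo ⟨u, ?_⟩⟩, fun h1 hu => (h1 hu).1⟩
        exact Finset.mem_filter.2 ⟨huA, (DCT16.pathIn_of_mem_openConnIn hu).right_mem⟩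
      rw [ha, hb, hset]
  ----------------------------------------------------------------
  -- choose the certifying relay and close with the algebraic step
  ----------------------------------------------------------------
  obtain ⟨α, hαA, hCM, hRM⟩ : ∃ α ∈ A,
      (g = h ∨ ∃ d₁ e₁ : ℝ, e₁ ≤ g - h ∧ g - h ≤ d₁ * (1 - h) ∧
        d₁ - q * (1 - a) * e₁ ≤ (prodBernoulli w).real (openConn α c : Set (BondConfig (Fin n)))ᶜ) ∧
      (a = b ∨ ∃ d' e' : ℝ, e' ≤ a - b ∧ a - b ≤ d' * (1 - b) ∧
        d' - q * (1 - g) * e' ≤ (prodBernoulli w).real (openConn α c : Set (BondConfig (Fin n)))ᶜ) := by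
    rcases hC with hC0 | ⟨α₁, hα₁A, d₁, e₁, hC1, hC2, hC3⟩ <;>
      rcases hR with hR0 | ⟨α', hα'A, d', e', hR1, hR2, hR3⟩
    · obtain ⟨α, hαA⟩ := hA
      exact ⟨α, hαA, Or.inl hC0, Or.inl hR0⟩
    · exact ⟨α', hα'A, Or.inl hC0, Or.inr ⟨d', e', hR1, hR2, hR3.ge⟩⟩
    · exact ⟨α₁, hα₁A, Or.inr ⟨d₁, e₁, hC1, hC2, hC3.ge⟩, Or.inl hR0⟩
    · rcases le_total ((prodBernoulli w).real (openConn α₁ c : Set (BondConfig (Fin n)))ᶜ)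
          ((prodBernoulli w).real (openConn α' c : Set (BondConfig (Fin n)))ᶜ) with hle | hle
      · exact ⟨α', hα'A, Or.inr ⟨d₁, e₁, hC1, hC2, hC3.ge.trans hle⟩, Or.inr ⟨d', e', hR1, hR2, hR3.ge⟩⟩
      · exact ⟨α₁, hα₁A, Or.inr ⟨d₁, e₁, hC1, hC2, hC3.ge⟩, Or.inr ⟨d', e', hR1, hR2, hR3.ge.trans hle⟩⟩
  refine ⟨α, hαA, ?_⟩
  have hG : (1 - q) + q * g = 1 - q * (1 - g) := by ring
  have hH : (1 - q) + q * h = 1 - q * (1 - h) := by ring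
  rw [hM1, hM2, hG, hH]
  exact step_or a b g h q _ hb0 hba ha1 hh0 hhg hg1 hq0 hq1 measureReal_nonneg hCM hRM

end ApexForest

end Summit.CriticalPhenomena.PercolationContinuityZ3.Theorems
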